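import Summits.KontsevichZagierPeriods.KontsevichZagierPeriods.Theorems.FurushoPentagonPentagonInKZCornerCubes
import Summits.KontsevichZagierPeriods.KontsevichZagierPeriods.Theorems.FurushoPentagonPentagonInKZCornerEngineMoveAux
import Summits.KontsevichZagierPeriods.KontsevichZagierPeriods.Theorems.FurushoPentagonPentagonInKZCornerEngineEulerAux
import Summits.KontsevichZagierPeriods.KontsevichZagierPeriods.Theorems.FurushoPentagonPentagonInKZCornerEngineExistEAux

/-!
# `PentagonInKZ`, line `edge-normal-newton-leibniz`: corner engine — the direct route `stepA_direct`

Step A.4 of the abstract corner engine (proof of `cornerEngine_uniformlyNull`, crux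
`FurushoPentagon.PentagonInKZ`, stmt-KontsevichZagierPeriods-11348), in the engine's abstract
signature (hypothesised dictionaries, ONE hypothesis bundle `H`).

THE STATEMENT.  For the regularised letter `a = ℓ` (`fd_ℓ(t, ·) = 1/t`) in degree `k + (l''+1)`,
parameters `θ' ∈ [0,1]^{e+1}` (`Ξ₁ = Ξ(init θ') θ'_last`, `Η₁ = Η(init θ')`, `ρ = (σ Ξ)(init θ')`),
the class of `Q = ⟦ρ [fd_ℓ(Ξ₁,Η₁) B^{μ∘op ℓ}(x,y;Ξ₁,Η₁) − fd_ℓ(Ξ₁,0) B^{μ∘op ℓ}(x,y;Ξ₁,0)]⟧` equals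
the class of the level-`(k+l'')` integrand
`E = ⟦ρ₂ fd_ℓ(Ξ₂,Η₂) Σ_b gd_b(Ξ₂,Η₂) B^{(μ∘op ℓ)∘opV b}(x', y'; Ξ₂, Η₂)⟧` (`Η₂ = Η(θ₀) s'`).

THE PROOF (no Newton–Leibniz).  `B(…; Ξ₁, 0) = 0` (`qe_Bf_eta_zero`); move `y₀` to the last slot,
where it becomes the new parameter `s'` (rule (2), `CornerEngineMove.moveY0_rep`); on the open cube
the two integrands agree pointwise by (★B) (`CornerEngineMove.starB`, with `y₀ = s' ≠ 0`,
`η = Η(θ₀) ≠ 0`, `0 < Ξ₂ ≤ α` — or everything vanishes when `σ(θ₀) = 0`, by the normalisation of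
`σ`); conclude by congruence off a null set (`CornerCubes.cls_congr_open`).

References: [KontsevichZagier2001, §1.2 rule (2)]; V. G. Drinfeld, Leningrad Math. J. 2 (1991), §2.
-/

noncomputable section

open Set MeasureTheory
open Literature.NumberTheory.Transcendental
open Literature.ModelTheory.ExponentialFields (IsSemialgebraic)

namespace Summit.KontsevichZagierPeriods.FurushoPentagon.PentagonInKZ

section AbstractEngine

variable {m N : ℕ} {ℓ ℓ' : Fin (m + 2)} {α β : ℚ}
  {Zq : Fin (m + 2) → (DrinfeldKohnoTrunc ℚ (Fin 4) N)} {wZ : ∀ {n : ℕ}, (Fin n → Fin (m + 2)) → (DrinfeldKohnoTrunc ℚ (Fin 4) N)}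
  {fd gd dd : Fin (m + 2) → ℝ → ℝ → ℝ}
  {Ht Vt dHt dVt : ∀ {n : ℕ}, (Fin n → Fin (m + 2)) → (Fin n → ℝ) → ℝ → ℝ → ℝ}
  {op opV : Fin (m + 2) → (DrinfeldKohnoTrunc ℚ (Fin 4) N) →ₗ[ℚ] (DrinfeldKohnoTrunc ℚ (Fin 4) N)}
  {Af Bf dAf dBf F : ((DrinfeldKohnoTrunc ℚ (Fin 4) N) →ₗ[ℚ] ℚ) → ∀ {k l : ℕ}, (Fin k → ℝ) → (Fin l → ℝ) → ℝ → ℝ → ℝ}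
  {Xb : ∀ k l e : ℕ, (Fin (k + l + e) → ℝ) → Fin k → ℝ}
  {Yb : ∀ k l e : ℕ, (Fin (k + l + e) → ℝ) → Fin l → ℝ}
  {Θb : ∀ k l e : ℕ, (Fin (k + l + e) → ℝ) → Fin e → ℝ}

variable (H :
    (∀ {n : ℕ} (U : Fin n → Fin (m + 2)), wZ U = ((List.ofFn U).map Zq).prod) ∧
    (∀ (a : Fin (m + 2)) (X : (DrinfeldKohnoTrunc ℚ (Fin 4) N)), op a X = if a = ℓ then Zq ℓ * X - X * Zq ℓ else Zq a * X) ∧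
    (∀ (b : Fin (m + 2)) (X : (DrinfeldKohnoTrunc ℚ (Fin 4) N)), opV b X = if b = ℓ' then Zq ℓ' * X - X * Zq ℓ' else Zq b * X) ∧
    (∀ (μ : (DrinfeldKohnoTrunc ℚ (Fin 4) N) →ₗ[ℚ] ℚ) {k l : ℕ} (x : Fin k → ℝ) (y : Fin l → ℝ) (ξ η : ℝ), Af μ x y ξ η = ∑ U : Fin k → Fin (m + 2), ∑ V : Fin l → Fin (m + 2), (μ (wZ U * wZ V) : ℝ) * (Ht U x ξ η * Vt V y 0 η)) ∧
    (∀ (μ : (DrinfeldKohnoTrunc ℚ (Fin 4) N) →ₗ[ℚ] ℚ) {k l : ℕ} (x : Fin k → ℝ) (y : Fin l → ℝ) (ξ η : ℝ), Bf μ x y ξ η = ∑ U : Fin k → Fin (m + 2), ∑ V : Fin l → Fin (m + 2), (μ (wZ V * wZ U) : ℝ) * (Vt V y ξ η * Ht U x ξ 0)) ∧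
    (∀ (μ : (DrinfeldKohnoTrunc ℚ (Fin 4) N) →ₗ[ℚ] ℚ) {k l : ℕ} (x : Fin k → ℝ) (y : Fin l → ℝ) (ξ η : ℝ), dAf μ x y ξ η = ∑ U : Fin k → Fin (m + 2), ∑ V : Fin l → Fin (m + 2), (μ (wZ U * wZ V) : ℝ) * (dHt U x ξ η * Vt V y 0 η)) ∧
    (∀ (μ : (DrinfeldKohnoTrunc ℚ (Fin 4) N) →ₗ[ℚ] ℚ) {k l : ℕ} (x : Fin k → ℝ) (y : Fin l → ℝ) (ξ η : ℝ), dBf μ x y ξ η = ∑ U : Fin k → Fin (m + 2), ∑ V : Fin l → Fin (m + 2), (μ (wZ V * wZ U) : ℝ) * (dVt V y ξ η * Ht U x ξ 0)) ∧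
    (∀ (μ : (DrinfeldKohnoTrunc ℚ (Fin 4) N) →ₗ[ℚ] ℚ) {k l : ℕ} (x : Fin k → ℝ) (y : Fin l → ℝ) (ξ η : ℝ), F μ x y ξ η = Af μ x y ξ η - Bf μ x y ξ η) ∧
    (∀ (k l e : ℕ) (z : Fin (k + l + e) → ℝ), Xb k l e z = fun i => z (Fin.castAdd e (Fin.castAdd l i))) ∧
    (∀ (k l e : ℕ) (z : Fin (k + l + e) → ℝ), Yb k l e z = fun j => z (Fin.castAdd e (Fin.natAdd k j))) ∧
    (∀ (k l e : ℕ) (z : Fin (k + l + e) → ℝ), Θb k l e z = fun s => z (Fin.natAdd (k + l) s)) ∧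
    (∀ (U : Fin 0 → Fin (m + 2)) (x : Fin 0 → ℝ) (ξ η : ℝ), Ht U x ξ η = 1) ∧
    (∀ (V : Fin 0 → Fin (m + 2)) (y : Fin 0 → ℝ) (ξ η : ℝ), Vt V y ξ η = 1) ∧
    (∀ (U : Fin 0 → Fin (m + 2)) (x : Fin 0 → ℝ) (ξ η : ℝ), dHt U x ξ η = 0) ∧
    (∀ (V : Fin 0 → Fin (m + 2)) (y : Fin 0 → ℝ) (ξ η : ℝ), dVt V y ξ η = 0) ∧
    (∀ {k : ℕ} (U : Fin (k + 1) → Fin (m + 2)) (x : Fin (k + 1) → ℝ) (η : ℝ), Ht U x 0 η = 0) ∧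
    (∀ {l : ℕ} (V : Fin (l + 1) → Fin (m + 2)) (y : Fin (l + 1) → ℝ) (ξ : ℝ), Vt V y ξ 0 = 0) ∧
    (∀ t y : ℝ, fd ℓ t y = 1 / t) ∧
    (∀ x s : ℝ, gd ℓ' x s = 1 / s) ∧
    (∀ x y : ℝ, dd ℓ x y = 0) ∧
    (∀ x y : ℝ, dd ℓ' x y = 0) ∧
    (∀ (μ : (DrinfeldKohnoTrunc ℚ (Fin 4) N) →ₗ[ℚ] ℚ) {k : ℕ} (x₀ : ℝ) (x' : Fin k → ℝ) (ξ η : ℝ), ∑ U : Fin (k + 1) → Fin (m + 2), (μ (wZ U) : ℝ) * Ht U (Fin.cons x₀ x') ξ η = (∑ a : Fin (m + 2), (if a = ℓ then 1 / x₀ else ξ * fd a (ξ * x₀) η) * ∑ U' : Fin k → Fin (m + 2), (μ (Zq a * wZ U') : ℝ) * Ht U' x' (ξ * x₀) η) - (1 / x₀) * ∑ U' : Fin k → Fin (m + 2), (μ (wZ U' * Zq ℓ) : ℝ) * Ht U' x' (ξ * x₀) η) ∧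
    (∀ (μ : (DrinfeldKohnoTrunc ℚ (Fin 4) N) →ₗ[ℚ] ℚ) {l : ℕ} (y₀ : ℝ) (y' : Fin l → ℝ) (ξ η : ℝ), ∑ V : Fin (l + 1) → Fin (m + 2), (μ (wZ V) : ℝ) * Vt V (Fin.cons y₀ y') ξ η = (∑ b : Fin (m + 2), (if b = ℓ' then 1 / y₀ else η * gd b ξ (η * y₀)) * ∑ V' : Fin l → Fin (m + 2), (μ (Zq b * wZ V') : ℝ) * Vt V' y' ξ (η * y₀)) - (1 / y₀) * ∑ V' : Fin l → Fin (m + 2), (μ (wZ V' * Zq ℓ') : ℝ) * Vt V' y' ξ (η * y₀)) ∧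
    (∀ (μ : (DrinfeldKohnoTrunc ℚ (Fin 4) N) →ₗ[ℚ] ℚ) {l : ℕ} (P Q : (DrinfeldKohnoTrunc ℚ (Fin 4) N)) (y : Fin l → ℝ) (η : ℝ), (∀ i, 0 < y i ∧ y i < 1) → 0 < η → η ≤ (β : ℝ) → ∑ V : Fin l → Fin (m + 2), (μ (P * (Zq ℓ * wZ V - wZ V * Zq ℓ) * Q) : ℝ) * Vt V y 0 η = 0) ∧
    (∀ (μ : (DrinfeldKohnoTrunc ℚ (Fin 4) N) →ₗ[ℚ] ℚ) {k : ℕ} (P Q : (DrinfeldKohnoTrunc ℚ (Fin 4) N)) (x : Fin k → ℝ) (ξ : ℝ), (∀ i, 0 < x i ∧ x i < 1) → 0 < ξ → ξ ≤ (α : ℝ) → ∑ U : Fin k → Fin (m + 2), (μ (P * (Zq ℓ' * wZ U - wZ U * Zq ℓ') * Q) : ℝ) * Ht U x ξ 0 = 0) ∧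
    (∀ (μ : (DrinfeldKohnoTrunc ℚ (Fin 4) N) →ₗ[ℚ] ℚ) (P Q : (DrinfeldKohnoTrunc ℚ (Fin 4) N)), μ (P * (Zq ℓ * Zq ℓ' - Zq ℓ' * Zq ℓ) * Q) = 0) ∧
    (∀ (μ : (DrinfeldKohnoTrunc ℚ (Fin 4) N) →ₗ[ℚ] ℚ) (P Q : (DrinfeldKohnoTrunc ℚ (Fin 4) N)) (x y : ℝ), 0 < x → x < (α : ℝ) → 0 < y → y < (β : ℝ) → ∑ a : Fin (m + 2), ∑ b : Fin (m + 2), (fd a x y * gd b x y) * (μ (P * (Zq a * Zq b - Zq b * Zq a) * Q) : ℝ) = 0) ∧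
    (∀ (μ : (DrinfeldKohnoTrunc ℚ (Fin 4) N) →ₗ[ℚ] ℚ) (P Q : (DrinfeldKohnoTrunc ℚ (Fin 4) N)) (s : ℝ), 0 < s → s < (β : ℝ) → ∑ b : Fin (m + 2), gd b 0 s * (μ (P * (Zq ℓ * Zq b - Zq b * Zq ℓ) * Q) : ℝ) = 0) ∧
    (∀ (μ : (DrinfeldKohnoTrunc ℚ (Fin 4) N) →ₗ[ℚ] ℚ) (P Q : (DrinfeldKohnoTrunc ℚ (Fin 4) N)) (t : ℝ), 0 < t → t < (α : ℝ) → ∑ a : Fin (m + 2), fd a t 0 * (μ (P * (Zq ℓ' * Zq a - Zq a * Zq ℓ') * Q) : ℝ) = 0) ∧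
    (∀ (a : Fin (m + 2)) (ξ η : ℝ), 0 ≤ ξ → ξ ≤ (α : ℝ) → 0 ≤ η → η ≤ (β : ℝ) → HasDerivAt (fun y => fd a ξ y) (dd a ξ η) η) ∧
    (∀ (b : Fin (m + 2)) (ξ η : ℝ), 0 ≤ ξ → ξ ≤ (α : ℝ) → 0 ≤ η → η ≤ (β : ℝ) → HasDerivAt (fun x => gd b x η) (dd b ξ η) ξ) ∧
    (∀ {k : ℕ} (U : Fin k → Fin (m + 2)) (x : Fin k → ℝ) (ξ η : ℝ), (∀ i, 0 ≤ x i ∧ x i ≤ 1) → 0 ≤ ξ → ξ ≤ (α : ℝ) → 0 ≤ η → η ≤ (β : ℝ) → HasDerivAt (fun t => Ht U x t η) (dHt U x ξ η) ξ) ∧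
    (∀ {l : ℕ} (V : Fin l → Fin (m + 2)) (y : Fin l → ℝ) (ξ η : ℝ), (∀ i, 0 ≤ y i ∧ y i ≤ 1) → 0 ≤ ξ → ξ ≤ (α : ℝ) → 0 ≤ η → η ≤ (β : ℝ) → HasDerivAt (fun s => Vt V y ξ s) (dVt V y ξ η) η) ∧
    (∀ {k : ℕ} (U : Fin (k + 1) → Fin (m + 2)) (x₀ : ℝ) (x' : Fin k → ℝ) (ξ η : ℝ), 0 < x₀ → x₀ < 1 → (∀ i, 0 ≤ x' i ∧ x' i ≤ 1) → 0 ≤ ξ → ξ ≤ (α : ℝ) → 0 ≤ η → η ≤ (β : ℝ) → HasDerivAt (fun t => t * Ht U (Fin.cons t x') ξ η) (ξ * dHt U (Fin.cons x₀ x') ξ η) x₀) ∧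
    (∀ {l : ℕ} (V : Fin (l + 1) → Fin (m + 2)) (y₀ : ℝ) (y' : Fin l → ℝ) (ξ η : ℝ), 0 < y₀ → y₀ < 1 → (∀ i, 0 ≤ y' i ∧ y' i ≤ 1) → 0 ≤ ξ → ξ ≤ (α : ℝ) → 0 ≤ η → η ≤ (β : ℝ) → HasDerivAt (fun t => t * Vt V (Fin.cons t y') ξ η) (η * dVt V (Fin.cons y₀ y') ξ η) y₀) ∧
    (∀ {k : ℕ} (U : Fin (k + 1) → Fin (m + 2)) (x' : Fin k → ℝ) (ξ η : ℝ), (∀ i, 0 ≤ x' i ∧ x' i ≤ 1) → 0 ≤ ξ → ξ ≤ (α : ℝ) → 0 ≤ η → η ≤ (β : ℝ) → ContinuousOn (fun t => t * Ht U (Fin.cons t x') ξ η) (Set.Icc 0 1)) ∧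
    (∀ {l : ℕ} (V : Fin (l + 1) → Fin (m + 2)) (y' : Fin l → ℝ) (ξ η : ℝ), (∀ i, 0 ≤ y' i ∧ y' i ≤ 1) → 0 ≤ ξ → ξ ≤ (α : ℝ) → 0 ≤ η → η ≤ (β : ℝ) → ContinuousOn (fun t => t * Vt V (Fin.cons t y') ξ η) (Set.Icc 0 1)) ∧
    (∀ {d : ℕ} {W : Set (Fin d → ℝ)}, IsSemialgebraic ℚ W → ∀ (a : Fin (m + 2)) {T Y : (Fin d → ℝ) → ℝ}, IsSemialgebraicFunOn ℚ W T → IsSemialgebraicFunOn ℚ W Y → IsSemialgebraicFunOn ℚ W fun z => fd a (T z) (Y z)) ∧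
    (∀ {d : ℕ} {W : Set (Fin d → ℝ)}, IsSemialgebraic ℚ W → ∀ (b : Fin (m + 2)) {T Y : (Fin d → ℝ) → ℝ}, IsSemialgebraicFunOn ℚ W T → IsSemialgebraicFunOn ℚ W Y → IsSemialgebraicFunOn ℚ W fun z => gd b (T z) (Y z)) ∧
    (∀ {d : ℕ} {W : Set (Fin d → ℝ)}, IsSemialgebraic ℚ W → ∀ (a : Fin (m + 2)) {T Y : (Fin d → ℝ) → ℝ}, IsSemialgebraicFunOn ℚ W T → IsSemialgebraicFunOn ℚ W Y → IsSemialgebraicFunOn ℚ W fun z => dd a (T z) (Y z)) ∧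
    (∀ {d : ℕ} {W : Set (Fin d → ℝ)}, IsSemialgebraic ℚ W → ∀ {n : ℕ} (U : Fin n → Fin (m + 2)) {X : (Fin d → ℝ) → Fin n → ℝ} {P Q : (Fin d → ℝ) → ℝ}, (∀ i, IsSemialgebraicFunOn ℚ W fun z => X z i) → IsSemialgebraicFunOn ℚ W P → IsSemialgebraicFunOn ℚ W Q → IsSemialgebraicFunOn ℚ W fun z => Ht U (X z) (P z) (Q z)) ∧
    (∀ {d : ℕ} {W : Set (Fin d → ℝ)}, IsSemialgebraic ℚ W → ∀ {n : ℕ} (V : Fin n → Fin (m + 2)) {Y : (Fin d → ℝ) → Fin n → ℝ} {P Q : (Fin d → ℝ) → ℝ}, (∀ i, IsSemialgebraicFunOn ℚ W fun z => Y z i) → IsSemialgebraicFunOn ℚ W P → IsSemialgebraicFunOn ℚ W Q → IsSemialgebraicFunOn ℚ W fun z => Vt V (Y z) (P z) (Q z)) ∧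
    (∀ {d : ℕ} {W : Set (Fin d → ℝ)}, IsSemialgebraic ℚ W → ∀ {n : ℕ} (U : Fin n → Fin (m + 2)) {X : (Fin d → ℝ) → Fin n → ℝ} {P Q : (Fin d → ℝ) → ℝ}, (∀ i, IsSemialgebraicFunOn ℚ W fun z => X z i) → IsSemialgebraicFunOn ℚ W P → IsSemialgebraicFunOn ℚ W Q → IsSemialgebraicFunOn ℚ W fun z => dHt U (X z) (P z) (Q z)) ∧
    (∀ {d : ℕ} {W : Set (Fin d → ℝ)}, IsSemialgebraic ℚ W → ∀ {n : ℕ} (V : Fin n → Fin (m + 2)) {Y : (Fin d → ℝ) → Fin n → ℝ} {P Q : (Fin d → ℝ) → ℝ}, (∀ i, IsSemialgebraicFunOn ℚ W fun z => Y z i) → IsSemialgebraicFunOn ℚ W P → IsSemialgebraicFunOn ℚ W Q → IsSemialgebraicFunOn ℚ W fun z => dVt V (Y z) (P z) (Q z)) ∧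
    (∃ C : ℝ, ∀ (a : Fin (m + 2)) (ξ η : ℝ), 0 ≤ ξ → ξ ≤ (α : ℝ) → 0 ≤ η → η ≤ (β : ℝ) → (a ≠ ℓ → |fd a ξ η| ≤ C) ∧ (a ≠ ℓ' → |gd a ξ η| ≤ C) ∧ |dd a ξ η| ≤ C ∧ (∀ η' : ℝ, 0 ≤ η' → η' ≤ (β : ℝ) → |fd a ξ η - fd a ξ η'| ≤ C * |η - η'|) ∧ (∀ ξ' : ℝ, 0 ≤ ξ' → ξ' ≤ (α : ℝ) → |gd a ξ η - gd a ξ' η| ≤ C * |ξ - ξ'|)) ∧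
    (∀ k : ℕ, ∃ C : ℝ, ∀ (U : Fin k → Fin (m + 2)) (x : Fin k → ℝ) (ξ η : ℝ), (∀ i, 0 ≤ x i ∧ x i ≤ 1) → 0 ≤ ξ → ξ ≤ (α : ℝ) → 0 ≤ η → η ≤ (β : ℝ) → |Ht U x ξ η| ≤ C ∧ |dHt U x ξ η| ≤ C ∧ (0 < k → |Ht U x ξ η| ≤ C * ξ) ∧ (∀ η' : ℝ, 0 ≤ η' → η' ≤ (β : ℝ) → |Ht U x ξ η - Ht U x ξ η'| ≤ C * ξ * |η - η'|)) ∧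
    (∀ l : ℕ, ∃ C : ℝ, ∀ (V : Fin l → Fin (m + 2)) (y : Fin l → ℝ) (ξ η : ℝ), (∀ i, 0 ≤ y i ∧ y i ≤ 1) → 0 ≤ ξ → ξ ≤ (α : ℝ) → 0 ≤ η → η ≤ (β : ℝ) → |Vt V y ξ η| ≤ C ∧ |dVt V y ξ η| ≤ C ∧ (0 < l → |Vt V y ξ η| ≤ C * η) ∧ (∀ ξ' : ℝ, 0 ≤ ξ' → ξ' ≤ (α : ℝ) → |Vt V y ξ η - Vt V y ξ' η| ≤ C * η * |ξ - ξ'|)))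

/-! ### Step A.4 — the regularised letter `a = ℓ`: direct route -/

/-- The base parameters `θ₀ = init (init Θ₂)` of a point `Θ₂` of the open cube `(0,1)^{e+2}` lie
in the closed cube `[0,1]^e`. [folklore] -/
theorem CornerEngineDirect.init_init_mem_cube (e : ℕ) (Θ₂ : Fin (e + 2) → ℝ)
    (hΘ : Θ₂ ∈ openUnitCube (e + 2)) : Fin.init (Fin.init Θ₂) ∈ KZ.cube e :=
  KZ.mem_cube.2 fun _ => KZ.mem_cube.1 (CornerCubes.openUnitCube_subset_cube hΘ) _

include H in
/-- **The direct route, pointwise**: at a point of the open cube (parameters `Θ₂`, blocks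
`x', y'`), `(σ Ξ)(θ₀)/Ξ₂ · [B(x', s' :: y'; Ξ₂, Η θ₀) − B(…; Ξ₂, 0)]` peels by (★B) into
`ρ₂ fd_ℓ(Ξ₂, Η₂) Σ_b gd_b(Ξ₂, Η₂) B^{(μ∘op ℓ)∘opV b}(x', y'; Ξ₂, Η₂)`. [cite: Drinfeld1991, §2] -/
theorem CornerEngineDirect.direct_point (μ : (DrinfeldKohnoTrunc ℚ (Fin 4) N) →ₗ[ℚ] ℚ) (k l'' e : ℕ)
    (Ξ Η σ : (Fin e → ℝ) → ℝ)
    (hΞΗ : ∀ θ ∈ KZ.cube e, 0 ≤ Ξ θ ∧ Ξ θ ≤ (α : ℝ) ∧ 0 ≤ Η θ ∧ Η θ ≤ (β : ℝ))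
    (hσ0 : ∀ θ ∈ KZ.cube e, Ξ θ = 0 ∨ Η θ = 0 → σ θ = 0)
    (Ξ₁ Η₁ ρ : (Fin (e + 1) → ℝ) → ℝ)
    (hΞ₁ : ∀ θ', Ξ₁ θ' = Ξ (Fin.init θ') * θ' (Fin.last e)) (hΗ₁ : ∀ θ', Η₁ θ' = Η (Fin.init θ'))
    (hρ : ∀ θ', ρ θ' = σ (Fin.init θ') * Ξ (Fin.init θ'))
    (Ξ₂ Η₂ ρ₂ : (Fin (e + 2) → ℝ) → ℝ)
    (hΞ₂ : ∀ θ'', Ξ₂ θ'' = Ξ (Fin.init (Fin.init θ'')) * θ'' (Fin.castSucc (Fin.last e)))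
    (hΗ₂ : ∀ θ'', Η₂ θ'' = Η (Fin.init (Fin.init θ'')) * θ'' (Fin.last (e + 1)))
    (hρ₂ : ∀ θ'', ρ₂ θ'' = σ (Fin.init (Fin.init θ'')) * Ξ (Fin.init (Fin.init θ'')) * Η (Fin.init (Fin.init θ'')))
    (x' : Fin k → ℝ) (y' : Fin l'' → ℝ) (Θ₂ : Fin (e + 2) → ℝ) (hx : ∀ i, 0 < x' i ∧ x' i < 1)
    (hΘ : Θ₂ ∈ openUnitCube (e + 2)) :
    ρ (Fin.init Θ₂) * (fd ℓ (Ξ₁ (Fin.init Θ₂)) (Η₁ (Fin.init Θ₂)) *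
          Bf (μ ∘ₗ op ℓ) x' (Fin.cons (Θ₂ (Fin.last (e + 1))) y') (Ξ₁ (Fin.init Θ₂)) (Η₁ (Fin.init Θ₂)) -
        fd ℓ (Ξ₁ (Fin.init Θ₂)) 0 *
          Bf (μ ∘ₗ op ℓ) x' (Fin.cons (Θ₂ (Fin.last (e + 1))) y') (Ξ₁ (Fin.init Θ₂)) 0) =
      ρ₂ Θ₂ * (fd ℓ (Ξ₂ Θ₂) (Η₂ Θ₂) * ∑ b : Fin (m + 2), gd b (Ξ₂ Θ₂) (Η₂ Θ₂) *
        Bf ((μ ∘ₗ op ℓ) ∘ₗ opV b) x' y' (Ξ₂ Θ₂) (Η₂ Θ₂)) := by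
  have H' := H
  obtain ⟨_, _, _, _, _, _, _, _, _, _, _, _, _, _, _, _, _, hfd_reg, -⟩ := H'
  -- the point data
  have hθ₀c : Fin.init (Fin.init Θ₂) ∈ KZ.cube e := CornerEngineDirect.init_init_mem_cube e Θ₂ hΘ
  obtain ⟨hΞ0, hΞα, -, -⟩ := hΞΗ _ hθ₀c
  have hs : 0 < Θ₂ (Fin.castSucc (Fin.last e)) ∧ Θ₂ (Fin.castSucc (Fin.last e)) < 1 := hΘ _
  have hs' : 0 < Θ₂ (Fin.last (e + 1)) ∧ Θ₂ (Fin.last (e + 1)) < 1 := hΘ _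
  -- level-`(e+1)` data read at `init Θ₂`
  have e1 : Ξ₁ (Fin.init Θ₂) = Ξ₂ Θ₂ := by rw [hΞ₁, hΞ₂]; rfl
  rw [qe_Bf_eta_zero H, mul_zero, sub_zero, e1, hΗ₁, hρ, hρ₂, hΗ₂]
  simp only [hfd_reg]
  by_cases hσ : σ (Fin.init (Fin.init Θ₂)) = 0
  · rw [hσ]; ring
  · have hΞne : Ξ (Fin.init (Fin.init Θ₂)) ≠ 0 := fun h => hσ (hσ0 _ hθ₀c (Or.inl h))
    have hΗne : Η (Fin.init (Fin.init Θ₂)) ≠ 0 := fun h => hσ (hσ0 _ hθ₀c (Or.inr h))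
    have hξ : 0 < Ξ₂ Θ₂ := by rw [hΞ₂]; exact mul_pos (lt_of_le_of_ne hΞ0 (Ne.symm hΞne)) hs.1
    have hξα : Ξ₂ Θ₂ ≤ (α : ℝ) := by rw [hΞ₂]; exact (mul_le_of_le_one_right hΞ0 hs.2.le).trans hΞα
    rw [CornerEngineMove.starB H (μ ∘ₗ op ℓ) (Θ₂ (Fin.last (e + 1))) y' x' (Ξ₂ Θ₂) (Η (Fin.init (Fin.init Θ₂))) hΗne
      hs'.1.ne' hx hξ hξα]
    rw [Finset.mul_sum, Finset.mul_sum, Finset.mul_sum, Finset.mul_sum]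
    refine Finset.sum_congr rfl fun b _ => ?_
    ring

include H in
/-- **Step A.4 (direct route for the regularised letter).** [cite: KontsevichZagier2001, §1.2 rule (2)] -/
theorem stepA_direct (μ : (DrinfeldKohnoTrunc ℚ (Fin 4) N) →ₗ[ℚ] ℚ) (k l'' e : ℕ) (Ξ Η σ : (Fin e → ℝ) → ℝ)
    (hΞΗ : ∀ θ ∈ KZ.cube e, 0 ≤ Ξ θ ∧ Ξ θ ≤ (α : ℝ) ∧ 0 ≤ Η θ ∧ Η θ ≤ (β : ℝ))
    (hσ0 : ∀ θ ∈ KZ.cube e, Ξ θ = 0 ∨ Η θ = 0 → σ θ = 0)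
    (Ξ₁ Η₁ ρ : (Fin (e + 1) → ℝ) → ℝ)
    (hΞ₁ : ∀ θ', Ξ₁ θ' = Ξ (Fin.init θ') * θ' (Fin.last e)) (hΗ₁ : ∀ θ', Η₁ θ' = Η (Fin.init θ'))
    (hρ : ∀ θ', ρ θ' = σ (Fin.init θ') * Ξ (Fin.init θ'))
    (Ξ₂ Η₂ ρ₂ : (Fin (e + 2) → ℝ) → ℝ)
    (hΞ₂ : ∀ θ'', Ξ₂ θ'' = Ξ (Fin.init (Fin.init θ'')) * θ'' (Fin.castSucc (Fin.last e)))
    (hΗ₂ : ∀ θ'', Η₂ θ'' = Η (Fin.init (Fin.init θ'')) * θ'' (Fin.last (e + 1)))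
    (hρ₂ : ∀ θ'', ρ₂ θ'' = σ (Fin.init (Fin.init θ'')) * Ξ (Fin.init (Fin.init θ'')) * Η (Fin.init (Fin.init θ'')))
    (Q : KZ.IntegralRep (k + (l'' + 1) + (e + 1))) (hQd : Q.domain = KZ.cube (k + (l'' + 1) + (e + 1)))
    (hQi : Q.integrand = fun w => ρ (Θb k (l'' + 1) (e + 1) w) *
      (fd ℓ (Ξ₁ (Θb k (l'' + 1) (e + 1) w)) (Η₁ (Θb k (l'' + 1) (e + 1) w)) *
          Bf (μ ∘ₗ op ℓ) (Xb k (l'' + 1) (e + 1) w) (Yb k (l'' + 1) (e + 1) w)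
            (Ξ₁ (Θb k (l'' + 1) (e + 1) w)) (Η₁ (Θb k (l'' + 1) (e + 1) w)) -
        fd ℓ (Ξ₁ (Θb k (l'' + 1) (e + 1) w)) 0 *
          Bf (μ ∘ₗ op ℓ) (Xb k (l'' + 1) (e + 1) w) (Yb k (l'' + 1) (e + 1) w)
            (Ξ₁ (Θb k (l'' + 1) (e + 1) w)) 0))
    (E : KZ.IntegralRep (k + l'' + (e + 2))) (hEd : E.domain = KZ.cube (k + l'' + (e + 2)))
    (hEi : E.integrand = fun w => ρ₂ (Θb k l'' (e + 2) w) *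
      (fd ℓ (Ξ₂ (Θb k l'' (e + 2) w)) (Η₂ (Θb k l'' (e + 2) w)) *
        ∑ b : Fin (m + 2), gd b (Ξ₂ (Θb k l'' (e + 2) w)) (Η₂ (Θb k l'' (e + 2) w)) *
          Bf ((μ ∘ₗ op ℓ) ∘ₗ opV b) (Xb k l'' (e + 2) w) (Yb k l'' (e + 2) w)
            (Ξ₂ (Θb k l'' (e + 2) w)) (Η₂ (Θb k l'' (e + 2) w)))) :
    KZ.toPeriodAlgebra (KZ.toFormalPeriod (KZ.of Q)) = KZ.toPeriodAlgebra (KZ.toFormalPeriod (KZ.of E)) := by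
  -- move `y₀` to the last slot (rule (2)): it becomes the new parameter `s'`
  obtain ⟨Q', hQ'd, hQ'i, hQ'c⟩ := CornerEngineMove.moveY0_rep H (k := k) (l := l'') (e := e + 1)
    (fun x y θ' => ρ θ' * (fd ℓ (Ξ₁ θ') (Η₁ θ') * Bf (μ ∘ₗ op ℓ) x y (Ξ₁ θ') (Η₁ θ') -
      fd ℓ (Ξ₁ θ') 0 * Bf (μ ∘ₗ op ℓ) x y (Ξ₁ θ') 0)) Q hQd hQi
  rw [← hQ'c]
  -- the two integrands agree on the open cube
  refine CornerCubes.cls_congr_open hQ'd hEd fun z hz => ?_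
  have ex : Xb k l'' (e + 1 + 1) z = Xb k l'' (e + 2) z := rfl
  have ey : Yb k l'' (e + 1 + 1) z = Yb k l'' (e + 2) z := rfl
  have eΘ : Θb k l'' (e + 1 + 1) z = Θb k l'' (e + 2) z := rfl
  have hz' : z ∈ openUnitCube (k + l'' + (e + 2)) := hz
  obtain ⟨hxo, -, hΘo⟩ := CornerEngineEuler.blocks_open H hz'
  rw [hQ'i, hEi]
  dsimp only
  rw [ex, ey, eΘ]
  exact CornerEngineDirect.direct_point H μ k l'' e Ξ Η σ hΞΗ hσ0 Ξ₁ Η₁ ρ hΞ₁ hΗ₁ hρ Ξ₂ Η₂ ρ₂ hΞ₂ hΗ₂ hρ₂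
    _ _ _ hxo hΘo

end AbstractEngine

/-- **Hook `cornerEngineDirect_init_init_mem_cube`** (registered form of
`CornerEngineDirect.init_init_mem_cube`): the base parameters of a point of the open cube
`(0,1)^{e+2}` lie in `[0,1]^e`. [folklore] -/
theorem cornerEngineDirect_init_init_mem_cube : ∀ (e : ℕ) (Θ₂ : Fin (e + 2) → ℝ), Θ₂ ∈ openUnitCube (e + 2) → Fin.init (Fin.init Θ₂) ∈ KZ.cube e :=
  fun e Θ₂ hΘ => CornerEngineDirect.init_init_mem_cube e Θ₂ hΘ

end Summit.KontsevichZagierPeriods.FurushoPentagon.PentagonInKZ
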